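import Mathlib
import Literature.AlgebraicGeometry.Resolution.VPreparedInitialLabel
import Literature.AlgebraicGeometry.Resolution.OrderAlongFormalBranch
import Literature.AlgebraicGeometry.Resolution.HironakaTauBaseChange
import HarnessLib

/-!
# Initial forms, `τ`, adaptedness and isolation in `{ord ≥ μ}` under `𝔪`-adic completion

Topic: `Literature/AlgebraicGeometry/Resolution`. Generic commutative algebra for «complete ONCE at the start»
(architecture (B) of the `τ = 1` endgame, `plan/inputs/N2-ENDGAME-DESIGN-p7b-v0.md`; the step Cossart–Jannsen–
Saito, LNM 2270, Thm. 8.24 take: "If `R` is complete, we can obtain the stronger conclusion …", and Cossart–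
Piltant 2008, proof of Prop. 4.4 p. 11: "a regular (possibly formal) curve `Γ`"): the degree-`μ` initial forms
`cl_μ(I)` of an ideal `I ⊆ 𝔪^μ` of a regular local ring, read in a regular system of parameters `c`, do not
change under `R → R̂ = AdicCompletion 𝔪 R` (`gr_𝔪 R = gr_𝔪̂ R̂`, density `R/𝔪^{μ+1} = R̂/𝔪̂^{μ+1}`), hence
neither do Hironaka's `τ` nor adaptedness (`cl_μ I ⊆ k·Y^μ`); and for a G-RING the ISOLATION of the closed
point in `{ord I ≥ μ}` (no non-maximal prime `𝔮` with `I R_𝔮 ⊆ 𝔮^μ R_𝔮`, the binder of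
`UniformKrullExponent.exists_uniform_krullExponent_of_isolated`) ascends to `R̂`. OURS bookkeeping; every
input is in the tree (`AdaptedSystems.mem_initialForms_iff_exists_inForm`, `WeightedInitialForms`,
`HironakaTauBaseChange.hironakaTau_image_map_eq`, `OrderAlongFormalBranch` / `OrderFlatLocalHom`,
`AdicCompletionRegular`, Mathlib `AdicCompletion`).

PROVED (no definitions, no named facts), `R` regular local of dimension `3`, `c` a regular system of parameters,
`ι : R → R̂`:
* `inForm_map_adicCompletion` — `in_n^{ι∘c}(ι f) = in_n^{c}(f)` (coefficients through `k(R) ≅ k(R̂)`);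
* `mem_initialForms_map_adicCompletion_iff` (B0) — `G ∈ cl_μ(I R̂)` iff `G` is the image of a form of `cl_μ(I)`;
* `forall_initialForms_map_adicCompletion` — adaptedness ascends; `hironakaTauAt_map_adicCompletion` (B0′) —
  `τ` is completion-invariant;
* `isolated_map_adicCompletion` (B1; `R` any local Noetherian G-ring) — isolation in `{ord ≥ μ}` ascends to
  `R̂`: for a prime `𝔓 ≠ 𝔪̂` of `R̂`, `𝔮 = 𝔓 ∩ R ≠ 𝔪` (as `𝔪R̂ = 𝔪̂` is maximal) and along the flat local
  `R_𝔮 → R̂_𝔓`, whose closed fibre is regular (G-ring), `ord` is preserved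
  (`mem_pow_maximalIdeal_iff_of_isRegularLocalRing_fiber`) — the local form of
  `OrderAlongFormalBranch.map_le_pow_maximalIdeal_localization_under`.

Consequence used by the `τ = 1` line: B1c (`exists_adapted_prepared_label_of_isolated`) applies in `R̂`
(a G-ring: `isGRing_of_isAdicComplete`) from data at `R`. AI-written formalization; weaker than expert review.
Resolution of singularities in dimension `≥ 4` / characteristic `p` is NOT proved here;
`CossartPiltant2008_prop44` (F-71) / T1 / N2 are NOT discharged by this file; no summit statement is proved.

## Sources

* H. Matsumura, *Commutative Ring Theory* (1986), §8 (Thm. 8.10–8.11: completion), §32 p. 256 (G-rings),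
  §22 (flat local homomorphisms). [Matsumura1987]
* V. Cossart, O. Piltant, J. Algebra 320 (2008), proof of Prop. 4.2 (`τ(x)`), proof of Prop. 4.4 p. 11.
  [CossartPiltant2008]
* V. Cossart, U. Jannsen, S. Saito, LNM 2270 (2020), Def. 8.2, (12.1), Thm. 8.24. [CossartJannsenSaito2020]
-/

noncomputable section

open IsLocalRing MvPolynomial

namespace Literature.AlgebraicGeometry.Resolution

universe u

variable {R : Type u} [CommRing R]

/-! ## Density `R/𝔪ⁿ = R̂/𝔪̂ⁿ` -/

section Density

variable [IsLocalRing R] [IsNoetherianRing R]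

/-- Every element of `R̂` is congruent to an element of `R` modulo `𝔪̂ⁿ` (private). [folklore] -/
private theorem exists_sub_algebraMap_mem_pow (x : AdicCompletion (maximalIdeal R) R) (n : ℕ) :
    ∃ a : R, x - algebraMap R (AdicCompletion (maximalIdeal R) R) a ∈
      maximalIdeal (AdicCompletion (maximalIdeal R) R) ^ n := by
  obtain ⟨a, ha⟩ := Ideal.Quotient.mk_surjective (AdicCompletion.evalₐ (maximalIdeal R) n x)
  refine ⟨a, ?_⟩
  rw [AdicCompletion.maximalIdeal_eq_map]
  exact AdicCompletion.sub_of_mem_pow_map_of_evalₐ_eq (maximalIdeal R)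
    (maximalIdeal R).fg_of_isNoetherianRing x a ha.symm

/-- **Density for ideals**: every `h ∈ I R̂` is congruent to some `ι h₀`, `h₀ ∈ I`, modulo `𝔪̂ⁿ`
(private). [folklore] -/
private theorem exists_sub_algebraMap_mem_pow_of_mem_map (I : Ideal R) (n : ℕ)
    {h : AdicCompletion (maximalIdeal R) R}
    (hh : h ∈ I.map (algebraMap R (AdicCompletion (maximalIdeal R) R))) :
    ∃ h₀ ∈ I, h - algebraMap R (AdicCompletion (maximalIdeal R) R) h₀ ∈
      maximalIdeal (AdicCompletion (maximalIdeal R) R) ^ n := by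
  -- the set of elements congruent to `ι(I)` modulo `𝔪̂ⁿ` is an ideal containing `ι(I)`
  let ι : R →+* AdicCompletion (maximalIdeal R) R := algebraMap R (AdicCompletion (maximalIdeal R) R)
  let S : Ideal (AdicCompletion (maximalIdeal R) R) :=
    { carrier := {x | ∃ x₀ ∈ I, x - ι x₀ ∈ maximalIdeal (AdicCompletion (maximalIdeal R) R) ^ n}
      zero_mem' := ⟨0, I.zero_mem, by rw [map_zero, sub_zero]; exact Ideal.zero_mem _⟩
      add_mem' := by
        rintro x y ⟨x₀, hx₀, hx⟩ ⟨y₀, hy₀, hy⟩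
        refine ⟨x₀ + y₀, I.add_mem hx₀ hy₀, ?_⟩
        have : x + y - ι (x₀ + y₀) = (x - ι x₀) + (y - ι y₀) := by rw [map_add]; ring
        rw [this]; exact Ideal.add_mem _ hx hy
      smul_mem' := by
        rintro r x ⟨x₀, hx₀, hx⟩
        obtain ⟨r₀, hr⟩ := exists_sub_algebraMap_mem_pow r n
        refine ⟨r₀ * x₀, I.mul_mem_left _ hx₀, ?_⟩
        have : r • x - ι (r₀ * x₀) = r * (x - ι x₀) + (r - ι r₀) * ι x₀ := by
          rw [smul_eq_mul, map_mul]; ring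
        rw [this]
        exact Ideal.add_mem _ (Ideal.mul_mem_left _ _ hx) (Ideal.mul_mem_right _ _ hr) }
  have hle : I.map ι ≤ S := by
    rw [Ideal.map_le_iff_le_comap]
    intro g hg
    exact ⟨g, hg, by rw [sub_self]; exact Ideal.zero_mem _⟩
  exact hle hh

end Density

/-! ## Initial forms along `R → R̂` -/

section Forms

variable [IsRegularLocalRing R] (c : Fin 3 → R)
  (hgen : Ideal.span {c 0, c 1, c 2} = maximalIdeal R) (hdim : ringKrullDim R = 3)
  {I : Ideal R} {μ : ℕ}

omit [IsRegularLocalRing R] in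
/-- `ι(F^{(w)}_ρ(c)) ⊆ F^{(w)}_ρ(ι ∘ c)` (private). [folklore] -/
private theorem map_weightedIdealW_le_of_comp {S : Type u} [CommRing S] (f : R →+* S) (w : Fin 3 → ℕ)
    (ρ : ℕ) : (weightedIdealW c w ρ).map f ≤ weightedIdealW (fun i => f (c i)) w ρ := by
  rw [weightedIdealW, Ideal.map_span, Ideal.span_le]
  rintro _ ⟨_, ⟨e, he, rfl⟩, rfl⟩
  have : f (monom3 c e) = monom3 (fun i => f (c i)) e := by
    simp only [monom3, map_mul, map_pow]
  rw [SetLike.mem_coe, this]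
  exact monomial_mem_weightedIdealW _ w he

omit [IsRegularLocalRing R] in
/-- `f(F(c)) = (f F)(f ∘ c)` (private). [folklore] -/
private theorem ringHom_eval_eq_eval_map {S : Type u} [CommRing S] (f : R →+* S) (F : MvPolynomial (Fin 3) R) :
    f (eval c F) = eval (fun i => f (c i)) (MvPolynomial.map f F) := by
  rw [MvPolynomial.eval_map]
  show f (eval₂ (RingHom.id R) c F) = _
  rw [MvPolynomial.eval₂_comp_left, RingHom.comp_id]
  rfl

/-- **Initial forms are functorial along a homomorphism of local rings** (private form): if `P`
is the `w`-initial form of `f` in degree `n` w.r.t. `c`, then `P̄` (coefficients pushed along the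
residue fields) is the `w`-initial form of `φ f` w.r.t. `φ ∘ c`. [cite: CossartJannsenSaito2020, Def. 8.2] -/
private theorem IsInForm.map_localHom {S : Type u} [CommRing S] [IsLocalRing S] (f : R →+* S)
    [IsLocalHom f] {w : Fin 3 → ℕ} {n : ℕ} {g : R} {P : MvPolynomial (Fin 3) (ResidueField R)}
    (h : IsInForm c w n g P) :
    IsInForm (fun i => f (c i)) w n (f g) (MvPolynomial.map (ResidueField.map f) P) := by
  obtain ⟨F, hF, rfl, hrem⟩ := h
  refine ⟨MvPolynomial.map f F, ?_, ?_, ?_⟩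
  · intro d hd
    rw [coeff_map] at hd
    exact hF (fun h0 => hd (by rw [h0, map_zero]))
  · rw [MvPolynomial.map_map, MvPolynomial.map_map]
    congr 1
  · rw [← ringHom_eval_eq_eval_map c f F, ← map_sub]
    exact map_weightedIdealW_le_of_comp c f w (n + 1) (Ideal.mem_map_of_mem _ hrem)

omit [IsRegularLocalRing R] in
/-- Elements congruent modulo `F_{n+1}` have the same initial form in degree `n` (private).
[folklore] -/
private theorem IsInForm.of_sub_mem_succ [IsLocalRing R] {w : Fin 3 → ℕ} {n : ℕ} {g g' : R}
    {P : MvPolynomial (Fin 3) (ResidueField R)} (h : IsInForm c w n g P)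
    (hgg' : g' - g ∈ weightedIdealW c w (n + 1)) : IsInForm c w n g' P := by
  obtain ⟨F, hF, hFP, hrem⟩ := h
  refine ⟨F, hF, hFP, ?_⟩
  have : g' - eval c F = (g' - g) + (g - eval c F) := by ring
  rw [this]; exact Ideal.add_mem _ hgg' hrem

include hgen in
/-- `(ι c₀, ι c₁, ι c₂) = 𝔪̂` (private bookkeeping). [folklore] -/
private theorem span_map_adicCompletion_eq :
    Ideal.span {(fun i => algebraMap R (AdicCompletion (maximalIdeal R) R) (c i)) 0, (fun i => algebraMap R (AdicCompletion (maximalIdeal R) R) (c i)) 1,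
        (fun i => algebraMap R (AdicCompletion (maximalIdeal R) R) (c i)) 2} =
      maximalIdeal (AdicCompletion (maximalIdeal R) R) := by
  have h := congrArg (Ideal.map (algebraMap R (AdicCompletion (maximalIdeal R) R))) hgen
  rw [Ideal.map_span, Set.image_insert_eq, Set.image_insert_eq, Set.image_singleton] at h
  rw [AdicCompletion.maximalIdeal_eq_map, ← h]

include hgen hdim in
/-- **`in_n(ι f) = in_n(f)` along `R → R̂`** (coefficients read through `k(R) ≅ k(R̂)`), for
`f ∈ F^{(w)}_n`. [cite: CossartJannsenSaito2020, Def. 8.2] [cite: Matsumura1987, §8] -/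
theorem inForm_map_adicCompletion {w : Fin 3 → ℕ} (hw : ∀ i, 0 < w i) {n : ℕ} {f : R}
    (hf : f ∈ weightedIdealW c w n) :
    inForm (fun i => algebraMap R (AdicCompletion (maximalIdeal R) R) (c i)) w n
        (algebraMap R (AdicCompletion (maximalIdeal R) R) f) =
      MvPolynomial.map (ResidueField.map (algebraMap R (AdicCompletion (maximalIdeal R) R)))
        (inForm c w n f) := by
  haveI : IsNoetherianRing (AdicCompletion (maximalIdeal R) R) :=
    isNoetherianRing_adicCompletion_maximalIdeal R
  haveI : IsRegularLocalRing (AdicCompletion (maximalIdeal R) R) := isRegularLocalRing_adicCompletion R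
  have hgenh := span_map_adicCompletion_eq c hgen
  have hdimh : ringKrullDim (AdicCompletion (maximalIdeal R) R) = 3 := by
    rw [ringKrullDim_adicCompletion, hdim]
  have h := (isInForm_inForm c hgen hdim hw hf).map_localHom c
    (algebraMap R (AdicCompletion (maximalIdeal R) R))
  exact (h.eq_inForm (fun i => algebraMap R (AdicCompletion (maximalIdeal R) R) (c i)) hgenh hdimh hw).symm

include hgen hdim in
/-- **B0. `cl_μ(I)` is completion-invariant.** For `I ⊆ 𝔪^μ` and `c` a regular system of parameters of the
regular local ring `R` (dimension `3`), a form `G` over `k(R̂)` lies in `cl_μ(I R̂)` w.r.t. `ι ∘ c` iff it is the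
image of a form of `cl_μ(I)` under the residue-field isomorphism `k(R) ≅ k(R̂)` (density `R/𝔪^{μ+1} = R̂/𝔪̂^{μ+1}`:
every `h ∈ I R̂` is `≡ h′ ∈ I mod 𝔪̂^{μ+1}`). [cite: Matsumura1987, §8 (Thm. 8.10, 8.11)]
[cite: CossartPiltant2008, proof of Prop. 4.2] -/
theorem mem_initialForms_map_adicCompletion_iff (hIμ : I ≤ maximalIdeal R ^ μ)
    (G : MvPolynomial (Fin 3) (ResidueField (AdicCompletion (maximalIdeal R) R))) :
    G ∈ initialForms (fun i => algebraMap R (AdicCompletion (maximalIdeal R) R) (c i))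
        (I.map (algebraMap R (AdicCompletion (maximalIdeal R) R))) μ ↔
      ∃ G₀ ∈ initialForms c I μ,
        MvPolynomial.map (ResidueField.map (algebraMap R (AdicCompletion (maximalIdeal R) R))) G₀ = G := by
  classical
  haveI : IsNoetherianRing (AdicCompletion (maximalIdeal R) R) :=
    isNoetherianRing_adicCompletion_maximalIdeal R
  haveI : IsRegularLocalRing (AdicCompletion (maximalIdeal R) R) := isRegularLocalRing_adicCompletion R
  have hmmap : maximalIdeal (AdicCompletion (maximalIdeal R) R) =
      (maximalIdeal R).map (algebraMap R (AdicCompletion (maximalIdeal R) R)) :=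
    AdicCompletion.maximalIdeal_eq_map
  have hgenh := span_map_adicCompletion_eq c hgen
  have hdimh : ringKrullDim (AdicCompletion (maximalIdeal R) R) = 3 := by
    rw [ringKrullDim_adicCompletion, hdim]
  have hgenr := span_range_eq_of_span_triple c hgen
  have hgenrh := span_range_eq_of_span_triple (fun i => algebraMap R (AdicCompletion (maximalIdeal R) R) (c i)) hgenh
  have h1 : ∀ i, 0 < (fun _ : Fin 3 => (1 : ℕ)) i := fun _ => Nat.one_pos
  have hIhμ : I.map (algebraMap R (AdicCompletion (maximalIdeal R) R)) ≤
      maximalIdeal (AdicCompletion (maximalIdeal R) R) ^ μ := by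
    rw [hmmap, ← Ideal.map_pow]; exact Ideal.map_mono hIμ
  constructor
  · intro hG
    obtain ⟨h, hh, rfl⟩ := (mem_initialForms_iff_exists_inForm
      (fun i => algebraMap R (AdicCompletion (maximalIdeal R) R) (c i)) hgenh hdimh hIhμ G).mp hG
    -- density: `h ≡ ι h₀ mod 𝔪̂^{μ+1}` with `h₀ ∈ I`
    obtain ⟨h₀, hh₀, hsub⟩ := exists_sub_algebraMap_mem_pow_of_mem_map I (μ + 1) hh
    have hh₀μ : h₀ ∈ weightedIdealW c (fun _ => 1) μ := by
      rw [weightedIdealW_one_eq_pow c hgenr]; exact hIμ hh₀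
    have hιh₀μ : algebraMap R (AdicCompletion (maximalIdeal R) R) h₀ ∈
        weightedIdealW (fun i => algebraMap R (AdicCompletion (maximalIdeal R) R) (c i))
          (fun _ => 1) μ := by
      rw [weightedIdealW_one_eq_pow (fun i => algebraMap R (AdicCompletion (maximalIdeal R) R) (c i)) hgenrh, hmmap,
        ← Ideal.map_pow]
      exact Ideal.mem_map_of_mem _ (hIμ hh₀)
    -- `in_μ(h) = in_μ(ι h₀) = ι in_μ(h₀)`
    have hin : IsInForm (fun i => algebraMap R (AdicCompletion (maximalIdeal R) R) (c i))
        (fun _ => 1) μ h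
        (inForm (fun i => algebraMap R (AdicCompletion (maximalIdeal R) R) (c i)) (fun _ => 1) μ
          (algebraMap R (AdicCompletion (maximalIdeal R) R) h₀)) := by
      refine IsInForm.of_sub_mem_succ (fun i => algebraMap R (AdicCompletion (maximalIdeal R) R) (c i))
        (isInForm_inForm (fun i => algebraMap R (AdicCompletion (maximalIdeal R) R) (c i)) hgenh hdimh h1 hιh₀μ) ?_
      rw [weightedIdealW_one_eq_pow (fun i => algebraMap R (AdicCompletion (maximalIdeal R) R) (c i)) hgenrh]; exact hsub
    refine ⟨inForm c (fun _ => 1) μ h₀,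
      (mem_initialForms_iff_exists_inForm c hgen hdim hIμ _).mpr ⟨h₀, hh₀, rfl⟩, ?_⟩
    rw [← inForm_map_adicCompletion c hgen hdim h1 hh₀μ]
    exact IsInForm.eq_inForm (fun i => algebraMap R (AdicCompletion (maximalIdeal R) R) (c i)) hgenh hdimh h1 hin
  · rintro ⟨G₀, hG₀, rfl⟩
    obtain ⟨g, hg, rfl⟩ := (mem_initialForms_iff_exists_inForm c hgen hdim hIμ G₀).mp hG₀
    have hgμ : g ∈ weightedIdealW c (fun _ => 1) μ := by
      rw [weightedIdealW_one_eq_pow c hgenr]; exact hIμ hg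
    rw [← inForm_map_adicCompletion c hgen hdim h1 hgμ]
    exact (mem_initialForms_iff_exists_inForm (fun i => algebraMap R (AdicCompletion (maximalIdeal R) R) (c i)) hgenh hdimh hIhμ _).mpr
      ⟨_, Ideal.mem_map_of_mem _ hg, rfl⟩

include hgen hdim in
/-- **B0, corollary (adaptedness is completion-invariant).** If every degree-`μ` initial form of `I ⊆ 𝔪^μ` is a
multiple of `Y^μ`, the same holds for `I R̂` w.r.t. `ι ∘ c`. [cite: CossartJannsenSaito2020, (12.1)]
[cite: Matsumura1987, §8] -/
theorem forall_initialForms_map_adicCompletion (hIμ : I ≤ maximalIdeal R ^ μ)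
    (h : ∀ G ∈ initialForms c I μ, ∃ a : ResidueField R, G = C a * X 0 ^ μ) :
    ∀ G ∈ initialForms (fun i => algebraMap R (AdicCompletion (maximalIdeal R) R) (c i))
        (I.map (algebraMap R (AdicCompletion (maximalIdeal R) R))) μ,
      ∃ a : ResidueField (AdicCompletion (maximalIdeal R) R), G = C a * X 0 ^ μ := by
  intro G hG
  obtain ⟨G₀, hG₀, rfl⟩ := (mem_initialForms_map_adicCompletion_iff c hgen hdim hIμ G).mp hG
  obtain ⟨a, rfl⟩ := h G₀ hG₀
  exact ⟨_, by rw [map_mul, map_C, map_pow, map_X]⟩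

include hgen hdim in
/-- **B0′. `τ` is completion-invariant** (`τ` of `cl_μ(I)` w.r.t. `c` equals `τ` of `cl_μ(I R̂)` w.r.t. `ι ∘ c`).
[cite: CossartPiltant2008, proof of Prop. 4.2] [cite: Matsumura1987, §8] -/
theorem hironakaTauAt_map_adicCompletion (hIμ : I ≤ maximalIdeal R ^ μ) :
    hironakaTauAt (fun i => algebraMap R (AdicCompletion (maximalIdeal R) R) (c i))
        (I.map (algebraMap R (AdicCompletion (maximalIdeal R) R))) μ = hironakaTauAt c I μ := by
  haveI : IsNoetherianRing (AdicCompletion (maximalIdeal R) R) :=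
    isNoetherianRing_adicCompletion_maximalIdeal R
  set e : ResidueField R ≃+* ResidueField (AdicCompletion (maximalIdeal R) R) :=
    RingEquiv.ofBijective (ResidueField.map (algebraMap R (AdicCompletion (maximalIdeal R) R)))
      (AdicCompletion.residueField_map_bijective R) with he
  have hset : (initialForms (fun i => algebraMap R (AdicCompletion (maximalIdeal R) R) (c i))
        (I.map (algebraMap R (AdicCompletion (maximalIdeal R) R))) μ :
          Set (MvPolynomial (Fin 3) (ResidueField (AdicCompletion (maximalIdeal R) R)))) =
      MvPolynomial.map (e : ResidueField R →+* _) ''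
        (initialForms c I μ : Set (MvPolynomial (Fin 3) (ResidueField R))) := by
    have hecoe : (e : ResidueField R →+* ResidueField (AdicCompletion (maximalIdeal R) R)) =
        ResidueField.map (algebraMap R (AdicCompletion (maximalIdeal R) R)) :=
      RingHom.ext fun _ => rfl
    ext G
    rw [SetLike.mem_coe, mem_initialForms_map_adicCompletion_iff c hgen hdim hIμ G, Set.mem_image,
      hecoe]
    simp only [SetLike.mem_coe]
  rw [hironakaTauAt, hironakaTauAt, hset]
  exact hironakaTau_image_map_eq e _

end Forms

/-! ## Isolation in `{ord ≥ μ}` ascends to the completion of a G-ring -/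

section Isolation

variable [IsLocalRing R] [IsNoetherianRing R]

/-- **B1. Isolation of the closed point in `{ord I ≥ μ}` ascends to the completion of a local G-ring** (the
local form of `OrderAlongFormalBranch.map_le_pow_maximalIdeal_localization_under`: along the flat local map
`R_𝔮 → R̂_𝔓`, `𝔮 = 𝔓 ∩ R`, whose closed fibre is regular, `ord` is preserved; and `𝔓 ∩ R = 𝔪 ⇒ 𝔓 = 𝔪̂`).
[cite: Matsumura1987, §32 p. 256] [cite: CossartPiltant2008, Prop. 4.4 (proof, p. 11)] -/
theorem isolated_map_adicCompletion (hG : IsGRing R) {I : Ideal R} {μ : ℕ}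
    (hisol : ∀ (𝔮 : Ideal R) [𝔮.IsPrime], 𝔮 ≠ maximalIdeal R →
      ¬ I.map (algebraMap R (Localization.AtPrime 𝔮)) ≤ maximalIdeal (Localization.AtPrime 𝔮) ^ μ)
    (𝔓 : Ideal (AdicCompletion (maximalIdeal R) R)) [𝔓.IsPrime]
    (h𝔓 : 𝔓 ≠ maximalIdeal (AdicCompletion (maximalIdeal R) R)) :
    ¬ (I.map (algebraMap R (AdicCompletion (maximalIdeal R) R))).map
        (algebraMap (AdicCompletion (maximalIdeal R) R) (Localization.AtPrime 𝔓)) ≤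
      maximalIdeal (Localization.AtPrime 𝔓) ^ μ := by
  intro hle
  set 𝔮 : Ideal R := 𝔓.under R with h𝔮
  -- `𝔮 ≠ 𝔪` since `𝔪 R̂ = 𝔪̂` is maximal
  have h𝔮ne : 𝔮 ≠ maximalIdeal R := by
    intro heq
    apply h𝔓
    refine ((maximalIdeal.isMaximal _).eq_of_le (Ideal.IsPrime.ne_top ‹_›) ?_).symm
    rw [AdicCompletion.maximalIdeal_eq_map, Ideal.map_le_iff_le_comap]
    intro r hr
    change r ∈ 𝔓.under R
    rw [← h𝔮, heq]
    exact hr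
  refine hisol 𝔮 h𝔮ne ?_
  set A := Localization.AtPrime 𝔮
  set B := Localization.AtPrime 𝔓
  -- the flat local homomorphism `A = R_𝔮 → B = (R^)_𝔓`
  haveI : 𝔓.LiesOver 𝔮 := ⟨rfl⟩
  letI : Algebra A B := Localization.AtPrime.algebraOfLiesOver 𝔮 𝔓
  have halg : algebraMap A B = Localization.localRingHom 𝔮 𝔓
      (algebraMap R (AdicCompletion (maximalIdeal R) R)) Ideal.LiesOver.over :=
    Localization.AtPrime.IsLiesOverAlgebra.algebraMap_eq
  haveI : IsLocalHom (algebraMap A B) := by rw [halg]; infer_instance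
  haveI : IsNoetherianRing (AdicCompletion (maximalIdeal R) R) :=
    isNoetherianRing_adicCompletion_maximalIdeal R
  haveI : IsLocalization.AtPrime R (maximalIdeal R) :=
    IsLocalization.of_le_isUnit fun x hx => by
      change IsUnit x
      have hx' : x ∉ maximalIdeal R := hx
      exact not_not.mp fun h => hx' ((mem_maximalIdeal x).mpr h)
  haveI : IsNoetherianRing A := inferInstance
  haveI : IsNoetherianRing B := inferInstance
  haveI : Module.Flat R B := Module.Flat.trans R (AdicCompletion (maximalIdeal R) R) B
  haveI : Module.Flat A B :=
    (Module.flat_iff_of_isLocalization (S := A) 𝔮.primeCompl (M := B)).mpr inferInstance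
  -- its closed fibre is a local ring of the formal fibre over `𝔮`, regular as `R` is a G-ring
  have hRH : IsRegularHom R (AdicCompletion (maximalIdeal R) R) :=
    hG.isRegularHom_completion_of_isLocalization_atPrime (maximalIdeal R) R
  have hF : IsRegularRing (𝔮.Fiber (AdicCompletion (maximalIdeal R) R)) := hRH.isRegularRing_fiber 𝔮
  have hreg₀ := isRegularLocalRing_quotient_of_isRegularRing_fiber (A := R)
    (B := AdicCompletion (maximalIdeal R) R) 𝔓 hF
  have hmax : (maximalIdeal A).map (algebraMap A B) = 𝔮.map (algebraMap R B) := by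
    rw [← Localization.AtPrime.map_eq_maximalIdeal, Ideal.map_map, ← IsScalarTower.algebraMap_eq]
  have hreg : IsRegularLocalRing (B ⧸ (maximalIdeal A).map (algebraMap A B)) := by
    rw [hmax]; exact hreg₀
  -- orders are preserved along `A → B`
  rw [Ideal.map_le_iff_le_comap]
  intro f hf
  rw [Ideal.mem_comap, mem_pow_maximalIdeal_iff_of_isRegularLocalRing_fiber hreg μ]
  have h1 : algebraMap A B (algebraMap R A f) =
      algebraMap (AdicCompletion (maximalIdeal R) R) B
        (algebraMap R (AdicCompletion (maximalIdeal R) R) f) := by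
    rw [← IsScalarTower.algebraMap_apply,
      IsScalarTower.algebraMap_apply R (AdicCompletion (maximalIdeal R) R) B]
  rw [h1]
  exact hle (Ideal.mem_map_of_mem _ (Ideal.mem_map_of_mem _ hf))

end Isolation

end Literature.AlgebraicGeometry.Resolution

end
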